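import Literature.Probability.FitznerVanDerHofstad2017.NobleImprovementInputsRem

/-!
# Sanity lemmas for the remainder-read tables `RemRead.pts`, `RemRead.order`, `RemRead.comps`
(pub-lace10 REVIEW-RUNBOOK, definition cards `RemRead.pts` / `RemRead.order`)

Review evidence only (ops-runbook sanity registry `registry/pub-lace10.json`); no new definitions.
`Literature/Probability/FitznerVanDerHofstad2017/NobleImprovementInputsRem.lean` indexes the ten hooked
remainder reads of the Stage-1 notebook (DIVERGENCE.md D55) by `RemRead` and attaches to each read `r`

* its endpoint set `r.pts d ⊆ ℤ^d` — cell 5: the unit vectors `{e_i}`; cell 8: `{x : |x|₁ = 2}`;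
  cell 11 (closed polygons): `{0}`; cell 12 (open polygons): `{x ≠ 0}`;
* its trail order `r.order CS` (`CS + 1` for cells 5 and 12, `CS + 2` for cells 8 and 11);
* its admissible compositions `r.comps CS` (lists of `n_r = r.glines` positive parts summing to `r.order CS`).

The lemmas below pin these tables to the notebook's words: membership in each endpoint set is exactly the
stated condition (with small explicit members and non-members in `ℤ²`), the two polygon sets are complementary,
the order exceeds the closing length by one or two (`19` / `20` at the closing length of record `CS = 18`, the
exponents `M` read in `Stage1EvalD10.lean`), and the composition rule is NON-VACUOUS: every read admits an
admissible composition as soon as `CS ≥ 3` (explicitly, `(5,5,5,4)` for the four-line open polygon at `CS = 18`).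
-/

namespace Summit.CriticalPhenomena.LaceExpansionHighD.Runbook

open Literature.Probability.FitznerVanDerHofstad2017 Literature.Probability.LatticeModels

variable {d : ℕ}

/-! ### Endpoint sets `RemRead.pts` -/

/-- Cell 5 (`g5`): every unit vector `e_i` is an endpoint. -/
theorem single_mem_pts_g5 (i : Fin d) : (Pi.single i 1 : Site d) ∈ RemRead.g5.pts d := ⟨i, rfl⟩

/-- Cell 5 (`g5`): membership IS being a unit vector `e_i` (the set is `range (i ↦ e_i)`, nothing more). -/
theorem mem_pts_g5_iff (x : Site d) : x ∈ RemRead.g5.pts d ↔ ∃ i : Fin d, (Pi.single i 1 : Site d) = x :=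
  Iff.rfl

/-- Cell 5 (`g5`): the origin is not an endpoint (`e_i ≠ 0`). -/
theorem zero_not_mem_pts_g5 : (0 : Site d) ∉ RemRead.g5.pts d := by
  rintro ⟨i, hi⟩
  have h := congrFun hi i
  simp at h

/-- Cell 8 (`g8`): membership is `|x|₁ = ∑ i |x i| = 2` — the `ℓ¹`-sphere of radius `2`. -/
theorem mem_pts_g8_iff (x : Site d) : x ∈ RemRead.g8.pts d ↔ ∑ i, |x i| = 2 := Iff.rfl

/-- Cell 8 (`g8`) in `ℤ²`: both shapes of points at `ℓ¹`-distance `2`, `(2, 0)` and `(1, -1)`, are endpoints;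
the unit vector `(1, 0)` (cell 5's endpoint) and the origin are not. -/
theorem pts_g8_examples :
    (![2, 0] : Site 2) ∈ RemRead.g8.pts 2 ∧ (![1, -1] : Site 2) ∈ RemRead.g8.pts 2 ∧
      (![1, 0] : Site 2) ∉ RemRead.g8.pts 2 ∧ (0 : Site 2) ∉ RemRead.g8.pts 2 := by
  simp only [mem_pts_g8_iff]
  decide

/-- Cell 11 (`cl j`, closed repulsive polygons): the endpoint set is `{0}`. -/
theorem mem_pts_cl_iff (j : Fin 4) (x : Site d) : x ∈ (RemRead.cl j).pts d ↔ x = 0 := Iff.rfl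

/-- Cell 12 (`op j`, open repulsive polygons): the endpoint set is `{x ≠ 0}` (a sup over it). -/
theorem mem_pts_op_iff (j : Fin 4) (x : Site d) : x ∈ (RemRead.op j).pts d ↔ x ≠ 0 := Iff.rfl

/-- The closed- and open-polygon endpoint sets are complementary in `ℤ^d` (together they exhaust the
lattice; the line count `j` plays no role in the set). -/
theorem pts_op_eq_compl_pts_cl (j j' : Fin 4) : (RemRead.op j).pts d = ((RemRead.cl j').pts d)ᶜ := by
  ext x
  rw [Set.mem_compl_iff, mem_pts_op_iff, mem_pts_cl_iff]

/-- The unit vector `e_i` (cell 5) is an open-polygon endpoint and not a closed-polygon one. -/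
theorem single_mem_pts_op (i : Fin d) (j : Fin 4) :
    (Pi.single i 1 : Site d) ∈ (RemRead.op j).pts d ∧ (Pi.single i 1 : Site d) ∉ (RemRead.cl j).pts d := by
  rw [mem_pts_op_iff, mem_pts_cl_iff, and_self]
  intro h
  have h' := congrFun h i
  simp at h'

/-! ### Trail order `RemRead.order` -/

/-- The trail order exceeds the closing length by one (cells 5, 12) or two (cells 8, 11). -/
theorem order_mem (CS : ℕ) (r : RemRead) : r.order CS = CS + 1 ∨ r.order CS = CS + 2 := by
  cases r <;> simp [RemRead.order]

/-- At the closing length of record `CS = 18`: `M = 19` for cells 5 and 12, `M = 20` for cells 8 and 11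
(the exponents of `(2d)^M` read in `Stage1EvalD10.lean`). -/
theorem order_at_18 (j : Fin 4) :
    RemRead.g5.order 18 = 19 ∧ (RemRead.op j).order 18 = 19 ∧
      RemRead.g8.order 18 = 20 ∧ (RemRead.cl j).order 18 = 20 :=
  ⟨rfl, rfl, rfl, rfl⟩

/-- The order always dominates the number of lines once `CS ≥ 3` (`n_r ≤ 4 ≤ CS + 1 ≤ M_r`) — the
arithmetic fact behind the non-vacuity of the composition rule below. -/
theorem glines_le_order {CS : ℕ} (hCS : 3 ≤ CS) (r : RemRead) : r.glines ≤ r.order CS := by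
  have h4 := r.glines_le_four
  rcases order_mem CS r with h | h <;> omega

/-! ### Admissible compositions `RemRead.comps`: the rule is non-vacuous -/

/-- Membership in `r.comps CS` unfolded: `n_r` parts, summing to `M_r`, all positive. -/
theorem mem_comps_iff (CS : ℕ) (r : RemRead) (c : List ℕ) :
    c ∈ r.comps CS ↔ c.length = r.glines ∧ c.sum = r.order CS ∧ ∀ m ∈ c, 1 ≤ m := Iff.rfl

/-- Explicit member: at `CS = 18` the four-line open polygon (`op 3`: `n = 4`, `M = 19`) admits the
composition `(5, 5, 5, 4)`. -/
theorem comps_op3_example : [5, 5, 5, 4] ∈ (RemRead.op 3).comps 18 := by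
  rw [mem_comps_iff]
  decide

/-- Explicit non-member: a composition with a ZERO part is not admissible (`(19, 0)` has the right sum for
the two-line open polygon `op 1` at `CS = 18` but a vanishing part). -/
theorem comps_op1_nonexample : [19, 0] ∉ (RemRead.op 1).comps 18 := by
  rw [mem_comps_iff]
  decide

/-- NON-VACUITY of the composition rule: for `CS ≥ 3` every read admits an admissible composition, namely
`(M_r - n_r + 1, 1, …, 1)`; so `RemValid d CS R` constrains every entry `R r` of a remainder table. -/
theorem comps_nonempty {CS : ℕ} (hCS : 3 ≤ CS) (r : RemRead) : (r.comps CS).Nonempty := by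
  have h1 := r.one_le_glines
  have hle := glines_le_order hCS r
  refine ⟨(r.order CS - (r.glines - 1)) :: List.replicate (r.glines - 1) 1, ?_, ?_, ?_⟩
  · rw [List.length_cons, List.length_replicate]
    omega
  · rw [List.sum_cons, List.sum_replicate, smul_eq_mul, mul_one]
    omega
  · intro m hm
    rw [List.mem_cons] at hm
    rcases hm with rfl | hm
    · omega
    · rw [List.mem_replicate] at hm
      omega

end Summit.CriticalPhenomena.LaceExpansionHighD.Runbook
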